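import Summits.KontsevichZagierPeriods.KontsevichZagierPeriods.Theorems.HyperbolicBlochOffTetraSectorKernelRungOne

/-!
# Stub `stub_rungOneStd` — crux `OffTetraSectorKernel`, line `odd-hyperbolic-ladder` (skeleton v7)

Rung 1 of the hyperbolic scissors ladder (areas of finite-area `ℚ̄`-geodesic polygons of the hyperbolic
plane, upper half-plane model `p : Fin 2 → ℝ`, `x = p 0`, `t = p 1`, density `t⁻²`): **every representation
`[P, t⁻²]` is, modulo the Kontsevich–Zagier moves, a signed sum of differences of STANDARD doubly-ideal
triangles** `Std γ = V γ 1 0 1 = {γ < x < 1, t > 0, x² + t² > 1}` (area `arccos γ`) with algebraic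
`γ ∈ [−1, 1]`. Pure plumbing of landed theorems:

* vertical cuts (`stub_verticalCuts`, with `stub_stripStructure` and `stub_vPiece` (i)) write `[P, t⁻²]` as a
  signed sum of V-pieces `V α β a c = {α < x < β, t > 0, (x − a)² + t² > c}` with algebraic data;
* one boundary similarity `(x, t) ↦ ((x − a)/√c, t/√c)` (`angleKernel_equivalent_normalised`) normalises each
  piece to `V α' β' 0 1`, `α' = (α − a)/√c < β' = (β − a)/√c` in `[−1, 1]`;
* one domain-additivity move (`angleKernel_split_std`) gives `[V α' β' 0 1] ≡ [Std α'] − [Std β']`, where for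
  `β' = 1` the (empty) standard triangle `Std 1` is represented by the empty representation.

References: M. Kontsevich, D. Zagier, *Periods* (2001), §1.2 rules (1), (2); J. Ratcliffe, *Foundations of
hyperbolic manifolds*, §3.5.
-/

noncomputable section

open Set MeasureTheory
open Literature.NumberTheory.Transcendental

namespace Summit.KontsevichZagierPeriods.HyperbolicBloch.OffTetraSectorKernel

/-- **STUB `stub_rungOneStd`**: every representation `[P, t⁻²]` of the area of a finite-area `ℚ̄`-geodesic
polygon of `ℍ²` is, modulo the moves, a signed sum of differences of standard doubly-ideal triangles
`Std γ = {γ < x < 1, t > 0, x² + t² > 1}` (`γ ∈ ℚ̄ ∩ [−1, 1]`): vertical cuts into V-pieces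
(`stub_verticalCuts`), one boundary similarity (`angleKernel_equivalent_normalised`) and one split
(`angleKernel_split_std`) per piece. [cite: KontsevichZagier2001, §1.2 rules (1), (2)] -/
theorem stub_rungOneStd :
    ∀ (r : KZ.IntegralRep 2), KZ.IsGeodesicPolytope 1 r.domain →
      EqOn r.integrand (fun p => 1 / p 1 ^ 2) r.domain →
      ∃ (m : ℕ) (γ δ : Fin m → ℝ) (s : Fin m → ℤ) (Sγ Sδ : Fin m → KZ.IntegralRep 2),
        (∀ j, IsAlgebraic ℚ (γ j) ∧ -1 ≤ γ j ∧ γ j ≤ 1 ∧ IsAlgebraic ℚ (δ j) ∧ -1 ≤ δ j ∧ δ j ≤ 1) ∧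
        (∀ j, (Sγ j).domain = {p | γ j < p 0 ∧ p 0 < 1 ∧ 0 < p 1 ∧ 1 < (p 0 - 0) ^ 2 + p 1 ^ 2} ∧
          EqOn (Sγ j).integrand (fun p => 1 / p 1 ^ 2) (Sγ j).domain) ∧
        (∀ j, (Sδ j).domain = {p | δ j < p 0 ∧ p 0 < 1 ∧ 0 < p 1 ∧ 1 < (p 0 - 0) ^ 2 + p 1 ^ 2} ∧
          EqOn (Sδ j).integrand (fun p => 1 / p 1 ^ 2) (Sδ j).domain) ∧
        KZ.of r - ∑ j, s j • (KZ.of (Sγ j) - KZ.of (Sδ j)) ∈ KZ.relations := by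
  classical
  intro r hP hri
  set V : ℝ → ℝ → ℝ → ℝ → Set (Fin 2 → ℝ) := fun α β a c => {p | α < p 0 ∧ p 0 < β ∧ 0 < p 1 ∧
    c < (p 0 - a) ^ 2 + p 1 ^ 2} with hVdef
  have hV : ∀ α β a c, V α β a c = {p | α < p 0 ∧ p 0 < β ∧ 0 < p 1 ∧ c < (p 0 - a) ^ 2 + p 1 ^ 2} :=
    fun _ _ _ _ => rfl
  have hRep := (stub_vPiece V hV).1
  /- vertical cuts of the polygon into V-pieces -/
  obtain ⟨m, α, β, a, c, s, W, hdata, hW, hrel⟩ :=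
    stub_verticalCuts V hV stub_stripStructure hRep r.domain hP r rfl hri
  /- the standard family `S γ` on `Std γ = V γ 1 0 1` (empty representation at `γ = 1`) -/
  have key : ∃ S : ℝ → KZ.IntegralRep 2, ∀ γ, IsAlgebraic ℚ γ → -1 ≤ γ → γ ≤ 1 →
      (S γ).domain = V γ 1 0 1 ∧ EqOn (S γ).integrand (fun p => 1 / p 1 ^ 2) (S γ).domain := by
    have hex : ∀ γ, IsAlgebraic ℚ γ ∧ -1 ≤ γ ∧ γ < 1 →
        ∃ r : KZ.IntegralRep 2, r.domain = V γ 1 0 1 ∧ r.integrand = fun p => 1 / p 1 ^ 2 :=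
      fun γ h => hRep γ 1 0 1 h.1 isAlgebraic_one isAlgebraic_zero isAlgebraic_one h.2.2
        (by rw [sub_zero]; nlinarith [h.2.1, h.2.2]) (by norm_num)
    refine ⟨fun γ => if h : IsAlgebraic ℚ γ ∧ -1 ≤ γ ∧ γ < 1 then Classical.choose (hex γ h)
      else KZ.IntegralRep.empty 2, fun γ hγ h1 h2 => ?_⟩
    by_cases hlt : γ < 1
    · have h : IsAlgebraic ℚ γ ∧ -1 ≤ γ ∧ γ < 1 := ⟨hγ, h1, hlt⟩
      simp only [dif_pos h]
      obtain ⟨hd, hi⟩ := Classical.choose_spec (hex γ h)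
      exact ⟨hd, fun p _ => by rw [hi]⟩
    · have hγ1 : γ = 1 := le_antisymm h2 (not_lt.mp hlt)
      subst hγ1
      have hn : ¬ (IsAlgebraic ℚ (1 : ℝ) ∧ -1 ≤ (1 : ℝ) ∧ (1 : ℝ) < 1) := fun h => lt_irrefl _ h.2.2
      simp only [dif_neg hn, KZ.IntegralRep.domain_empty]
      refine ⟨?_, fun p hp => hp.elim⟩
      rw [hV]
      ext p
      simp only [mem_empty_iff_false, mem_setOf_eq, false_iff, not_and]
      intro h h' _
      linarith
  obtain ⟨S, hS⟩ := key
  have hdom : ∀ γ, IsAlgebraic ℚ γ → -1 ≤ γ → γ ≤ 1 → (S γ).domain = V γ 1 0 1 :=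
    fun γ h h1 h2 => (hS γ h h1 h2).1
  have hint : ∀ γ, IsAlgebraic ℚ γ → -1 ≤ γ → γ ≤ 1 →
      EqOn (S γ).integrand (fun p => 1 / p 1 ^ 2) (S γ).domain := fun γ h h1 h2 => (hS γ h h1 h2).2
  /- normal form of each piece: `[W j] ≡ [S α'ⱼ] − [S β'ⱼ]` -/
  set α' : Fin m → ℝ := fun j => (α j - a j) * (Real.sqrt (c j))⁻¹ with hα'
  set β' : Fin m → ℝ := fun j => (β j - a j) * (Real.sqrt (c j))⁻¹ with hβ'
  have hcpos : ∀ j, 0 < c j := fun j => vPiece_c_pos (hdata j).2.2.2.2.1 (hdata j).2.2.2.2.2.1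
    (hdata j).2.2.2.2.2.2
  have hα'mem : ∀ j, -1 ≤ α' j ∧ α' j ≤ 1 := fun j =>
    angleKernel_normalised_mem (hcpos j) (hdata j).2.2.2.2.2.1
  have hβ'mem : ∀ j, -1 ≤ β' j ∧ β' j ≤ 1 := fun j =>
    angleKernel_normalised_mem (hcpos j) (hdata j).2.2.2.2.2.2
  have hlt' : ∀ j, α' j < β' j := fun j =>
    mul_lt_mul_of_pos_right (by linarith [(hdata j).2.2.2.2.1])
      (inv_pos.mpr (Real.sqrt_pos.mpr (hcpos j)))
  have hsalg : ∀ j, IsAlgebraic ℚ (Real.sqrt (c j))⁻¹ := fun j =>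
    (rungZero_isAlgebraic_sqrt (hdata j).2.2.2.1).inv
  have hα'alg : ∀ j, IsAlgebraic ℚ (α' j) := fun j => ((hdata j).1.sub (hdata j).2.2.1).mul (hsalg j)
  have hβ'alg : ∀ j, IsAlgebraic ℚ (β' j) := fun j => ((hdata j).2.1.sub (hdata j).2.2.1).mul (hsalg j)
  have hr'ex : ∀ j, ∃ r' : KZ.IntegralRep 2, r'.domain = V (α' j) (β' j) 0 1 ∧
      r'.integrand = fun p => 1 / p 1 ^ 2 := fun j =>
    hRep (α' j) (β' j) 0 1 (hα'alg j) (hβ'alg j) isAlgebraic_zero isAlgebraic_one (hlt' j)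
      (by rw [sub_zero]; nlinarith [(hα'mem j).1, (hα'mem j).2])
      (by rw [sub_zero]; nlinarith [(hβ'mem j).1, (hβ'mem j).2])
  choose r' hr'd hr'i using hr'ex
  have hpiece : ∀ j, KZ.of (W j) - (KZ.of (S (α' j)) - KZ.of (S (β' j))) ∈ KZ.relations := by
    intro j
    have e1 : KZ.of (W j) - KZ.of (r' j) ∈ KZ.relations :=
      angleKernel_equivalent_normalised hV (hcpos j) (hdata j).2.2.1 (hdata j).2.2.2.1 (W j) (r' j)
        (hW j).1 (fun p _ => by rw [(hW j).2]) (hr'd j) (fun p _ => by rw [hr'i j])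
    have e2 : KZ.of (S (α' j)) - KZ.of (r' j) - KZ.of (S (β' j)) ∈ KZ.relations :=
      angleKernel_split_std hV (hlt' j) (hβ'mem j).2 (S (α' j)) (r' j) (S (β' j))
        (hdom _ (hα'alg j) (hα'mem j).1 (hα'mem j).2) (hint _ (hα'alg j) (hα'mem j).1 (hα'mem j).2)
        (hr'd j) (fun p _ => by rw [hr'i j])
        (hdom _ (hβ'alg j) (hβ'mem j).1 (hβ'mem j).2) (hint _ (hβ'alg j) (hβ'mem j).1 (hβ'mem j).2)
    have : KZ.of (W j) - (KZ.of (S (α' j)) - KZ.of (S (β' j))) =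
        (KZ.of (W j) - KZ.of (r' j)) - (KZ.of (S (α' j)) - KZ.of (r' j) - KZ.of (S (β' j))) := by abel
    rw [this]
    exact sub_mem e1 e2
  /- assemble -/
  refine ⟨m, α', β', s, fun j => S (α' j), fun j => S (β' j),
    fun j => ⟨hα'alg j, (hα'mem j).1, (hα'mem j).2, hβ'alg j, (hβ'mem j).1, (hβ'mem j).2⟩,
    fun j => ⟨?_, hint _ (hα'alg j) (hα'mem j).1 (hα'mem j).2⟩,
    fun j => ⟨?_, hint _ (hβ'alg j) (hβ'mem j).1 (hβ'mem j).2⟩, ?_⟩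
  · rw [hdom _ (hα'alg j) (hα'mem j).1 (hα'mem j).2, hV]
  · rw [hdom _ (hβ'alg j) (hβ'mem j).1 (hβ'mem j).2, hV]
  · have hsplit : KZ.of r - ∑ j, s j • (KZ.of (S (α' j)) - KZ.of (S (β' j))) =
        (KZ.of r - ∑ j, s j • KZ.of (W j)) +
          ∑ j, s j • (KZ.of (W j) - (KZ.of (S (α' j)) - KZ.of (S (β' j)))) := by
      simp only [smul_sub, Finset.sum_sub_distrib]
      abel
    rw [hsplit]
    exact add_mem hrel (sum_mem fun j _ => zsmul_mem (hpiece j) _)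

end Summit.KontsevichZagierPeriods.HyperbolicBloch.OffTetraSectorKernel

end
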